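import Literature.Geometry.Lorentzian.LocalTwinParadox
import Literature.Geometry.Lorentzian.CauchyHypersurfaceCausalProofs
import Literature.Geometry.Lorentzian.CorrespondingBoundaryTimelike
import Literature.Geometry.Lorentzian.GlobalHyperbolicityStrongCausalityProofs
import HarnessLib

/-!
# The local formula for the time separation: `τ(p, q) = |exp_p⁻¹ q| = |exp_q⁻¹ p|` on a causally
# convex normal neighbourhood (O'Neill 1983, Prop. 5.34; Sbierski 2016, §3.2, proof of Thm. 12)

In a strongly causal time-oriented Lorentzian manifold every point has arbitrarily small
**causally convex** open neighbourhoods `U` — every causal curve of `M` with endpoints in `U` stays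
in `U` (Sbierski 2016, §3.2, footnote in the proof of Thm. 3.5 = arXiv Thm. 12: *"Pick two points
`p₁, p₂ ∈ V₂` such that `p₁ ≪ p ≪ p₂`. It follows that `W := I⁺(p₁) ∩ I⁻(p₂)` is an open
neighbourhood of `p` which is completely contained in `V₁` … Moreover, `W` is causally convex"*).
On such a `U` inside a uniformly normal neighbourhood `W` (`exists_nhds_arcLength_le_radial`,
`LocalTwinParadox.lean`) the time separation of `M` (`LorentzianMetric.lorentzDist`, O'Neill
1983, Def. 14.15) is given by the exponential map: for `p, q ∈ U` with `p < q`,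

  `τ(p, q) = |exp_p⁻¹ q| = |exp_q⁻¹ p|`,  `|v| = √(-g(v, v))`

(Sbierski, loc. cit.: *"`τ_q` restricted to `W` can be explicitly given by the exponential map
based at `q` … since `W` is causally convex, this geodesic must be completely contained in `W` —
and since `V ⊇ W` is convex, this geodesic is a radial one"*; O'Neill 1983, Ch. 5, Prop. 5.34: the
radial geodesic is the longest causal curve in a normal neighbourhood). We prove:

* `LorentzianMetric.IsStronglyCausal.exists_causallyConvex_nhds` — causally convex open
  neighbourhoods inside any given neighbourhood (Sbierski's footnote construction, with the
  spliced timelike curve through a point of `I⁺(p₁) ∩ I⁻(p₂)`, `exists_isFutureTimelikeCurveOn_splice`).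
* `LorentzianMetric.exists_nhds_lorentzDist_eq_radial` — the package of
  `exists_nhds_arcLength_le_radial` (`W`, two-point inverse `Ξ`) **together with the formula**:
  for every causally convex `U ⊆ W` and `p, q ∈ U` with `q ∈ J⁺(p)`, `q ≠ p`, the vector
  `v = exp_p⁻¹ q` is future causal, `w = exp_q⁻¹ p` is past causal, and
  `τ(p, q) = |v| = |w|` (as elements of `[0, ∞]`). The inequality `≤` is the local twin paradox
  applied to the causal curves from `p` to `q`, all of which lie in `U ⊆ W`; `≥` is the radial
  geodesic, a causal curve from `p` to `q` of length `|v|` (`arcLength_expMap_smul`).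

No maximal-geodesic existence (Avez–Seifert) and no continuity of `τ` is used. Everything is
proved; no definitions and no named facts are introduced (D-0026).

## References

* J. Sbierski, Ann. Henri Poincaré 17 (2016) 301–329 = arXiv:1309.7591v3, §3.2, proof of Thm. 12
  and its footnotes (arXiv numbering). [Sbierski2016AHP]
* B. O'Neill, *Semi-Riemannian geometry with applications to relativity*, Academic Press 1983,
  Ch. 5, Prop. 5.34 (p. 147); Ch. 14, Def. 14.11 (p. 407), Def. 14.15 (p. 409).
  [ONeillSemiRiemannian1983]
-/

noncomputable section

open Bundle Set Filter Function MeasureTheory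
open scoped Manifold ContDiff Topology ENNReal

namespace Literature.Geometry.Lorentzian

open Literature.Geometry.Riemannian

variable {E : Type*} [NormedAddCommGroup E] [NormedSpace ℝ E] {H : Type*} [TopologicalSpace H]
  {I : ModelWithCorners ℝ E H} {M : Type*} [TopologicalSpace M] [ChartedSpace H M]
  [IsManifold I ∞ M]

namespace LorentzianMetric

variable {n : ℕ∞ω} {g : LorentzianMetric I n M} {τ : TimeOrientation g}

/-! ### Causally convex neighbourhoods from strong causality -/

/-- **Strong causality yields arbitrarily small causally convex open neighbourhoods** (Sbierski
2016, §3.2, footnote in the proof of Thm. 12): for every neighbourhood `V` of `p` there is an open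
`U ∋ p`, `U ⊆ V`, such that every future causal curve segment of `M` with endpoints in `U` lies in
`U`. Construction: `U = I⁺(p₁) ∩ I⁻(p₂)` for points `p₁ ≪ p ≪ p₂` of a strong-causality
neighbourhood `V₂` of `p` (relative to `V`) on a short timelike curve through `p`; a point
`z ∈ U` lies on a timelike curve from `p₁` to `p₂` spliced at `z`
(`exists_isFutureTimelikeCurveOn_splice`), which stays in `V`; and `p₁ ≪ x ≤ z ≤ y ≪ p₂` gives
`z ∈ U` by push-up (O'Neill 1983, Cor. 14.1). [cite: Sbierski2016AHP, §3.2, proof of Thm. 12 (footnote on causally convex neighbourhoods)] -/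
theorem IsStronglyCausal.exists_causallyConvex_nhds [BoundarylessManifold I M]
    [FiniteDimensional ℝ E] (hn : 1 ≤ n) (hSC : g.IsStronglyCausal τ) (p : M) {V : Set M}
    (hV : V ∈ 𝓝 p) :
    ∃ U : Set M, IsOpen U ∧ p ∈ U ∧ U ⊆ V ∧
      ∀ (γ : ℝ → M) (a b : ℝ), a ≤ b → g.IsFutureCausalCurveOn τ γ (Icc a b) →
        γ a ∈ U → γ b ∈ U → MapsTo γ (Icc a b) U := by
  obtain ⟨V₂, hV₂, hV₂V, hbox⟩ := hSC p V hV
  -- a short timelike curve through `p` inside `V₂`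
  obtain ⟨μ, ε, hε, hμ0, hμ⟩ := g.exists_isFutureTimelikeCurveOn_Ioo_of_isInteriorPoint τ
    (BoundarylessManifold.isInteriorPoint (I := I) (x := p))
  have hμc : ContinuousAt μ 0 := (hμ 0 ⟨by linarith, hε⟩).1.continuousAt
  have hμV₂ : ∀ᶠ s in 𝓝 (0 : ℝ), μ s ∈ V₂ := hμc.preimage_mem_nhds (by rw [hμ0]; exact hV₂)
  obtain ⟨δ, hδ, hδV₂⟩ : ∃ δ, (0 < δ ∧ δ < ε) ∧ μ (-δ) ∈ V₂ ∧ μ δ ∈ V₂ := by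
    have h1 : ∀ᶠ s in 𝓝[>] (0 : ℝ), μ (-s) ∈ V₂ := by
      have hneg : Tendsto (fun s : ℝ ↦ -s) (𝓝 0) (𝓝 0) := by
        simpa using (continuous_neg.tendsto (0 : ℝ))
      exact (hneg.eventually hμV₂).filter_mono nhdsWithin_le_nhds
    have h2 : ∀ᶠ s in 𝓝[>] (0 : ℝ), μ s ∈ V₂ := hμV₂.filter_mono nhdsWithin_le_nhds
    have h3 : ∀ᶠ s in 𝓝[>] (0 : ℝ), 0 < s ∧ s < ε := by
      filter_upwards [Ioo_mem_nhdsGT hε] with s hs using hs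
    obtain ⟨δ, ⟨h1, h2⟩, h3⟩ := ((h1.and h2).and h3).exists
    exact ⟨δ, h3, h1, h2⟩
  set p₁ := μ (-δ) with hp₁
  set p₂ := μ δ with hp₂
  have hpp₁ : p ∈ g.chronologicalFuture τ {p₁} :=
    ⟨p₁, rfl, μ, -δ, 0, by linarith, hμ.mono (Icc_subset_Ioo (by linarith) hε), rfl, hμ0⟩
  have hpp₂ : p ∈ g.chronologicalPast τ {p₂} :=
    mem_chronologicalPast_of_mem_chronologicalFuture
      ⟨p, rfl, μ, 0, δ, hδ.1, hμ.mono (Icc_subset_Ioo (by linarith) hδ.2), hμ0, rfl⟩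
  set U : Set M := g.chronologicalFuture τ {p₁} ∩ g.chronologicalPast τ {p₂} with hU_def
  have hUo : IsOpen U := (isOpen_chronologicalFuture_of_boundaryless g τ {p₁}).inter
    (isOpen_chronologicalPast_of_boundaryless g τ {p₂})
  -- `U ⊆ V`: splice `p₁ ≪ z ≪ p₂` into one timelike curve through `z`
  have hUV : U ⊆ V := by
    rintro z ⟨hz₁, hz₂⟩
    obtain ⟨q₀, hq₀, γ₁, a₁, b₁, hab₁, hγ₁, hγ₁a, hγ₁b⟩ := hz₁
    rw [mem_singleton_iff] at hq₀
    subst hq₀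
    obtain ⟨x₀, hx₀, γ₂, a₂, b₂, hab₂, hγ₂, hγ₂a, hγ₂b⟩ :=
      mem_chronologicalFuture_of_mem_chronologicalPast hz₂
    rw [mem_singleton_iff] at hx₀
    subst hx₀
    obtain ⟨Γ, L, c, hL, h₁, h₂, hΓ, hΓleft, hΓright⟩ :=
      exists_isFutureTimelikeCurveOn_splice hab₁ hγ₁ hγ₁b hab₂ hγ₂ hγ₂a
    have hend : a₁ < b₂ - c := by linarith
    have hΓa : Γ a₁ = γ₁ a₁ := hΓleft a₁ hab₁.le
    have hΓb : Γ (b₂ - c) = γ₂ b₂ := by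
      rw [hΓright (b₂ - c) (by linarith)]
      congr 1
      ring
    have hmem := hbox Γ a₁ (b₂ - c) hend hΓ.isFutureCausalCurveOn (by rw [hΓa, hγ₁a]; exact hδV₂.1)
      (by rw [hΓb, hγ₂b]; exact hδV₂.2) b₁ ⟨hab₁.le, by linarith⟩
    rw [hΓleft b₁ le_rfl, hγ₁b] at hmem
    exact hmem
  refine ⟨U, hUo, ⟨hpp₁, hpp₂⟩, hUV, fun γ a b hab hγ hγa hγb t ht ↦ ?_⟩
  -- causal convexity by push-up
  have hxz : γ t ∈ g.causalFuture τ {γ a} := hγ.apply_mem_causalFuture_apply_left ht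
  have hzy : γ b ∈ g.causalFuture τ {γ t} := hγ.apply_right_mem_causalFuture_apply ht
  refine ⟨mem_chronologicalFuture_of_mem_chronologicalFuture_of_mem_causalFuture hn hγa.1 hxz, ?_⟩
  exact mem_chronologicalPast_of_mem_chronologicalFuture
    (mem_chronologicalFuture_of_mem_causalFuture hn hzy
      (mem_chronologicalFuture_of_mem_chronologicalPast hγb.2))

/-! ### The local formula for the time separation -/

variable [FiniteDimensional ℝ E] [CompleteSpace E] [T2Space M] [I.Boundaryless] [g.HasLeviCivita]
  [CovariantDerivative.ContMDiffCovariantDerivative g.leviCivita 1] (τ)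

/-- The radial geodesic `r ↦ exp_o(rv)`, `r ∈ [0, 1]`, is a future causal curve from `o` to
`exp_o v` for `v ∈ 𝓔_o` future causal (O'Neill 1983, Ch. 5, Prop. 5.34; Ch. 14, Lemma 14.2 (1)).
[cite: ONeillSemiRiemannian1983, Ch. 14, Lemma 14.2 (1) (p. 403)] -/
theorem isFutureCausalCurveOn_expMap_smul [Fact (1 ≤ n)] {o : M} {v : TangentSpace I o}
    (hv : v ∈ expDomain g.leviCivita o) (hvf : τ.IsFutureDirected v) :
    g.IsFutureCausalCurveOn τ (fun r : ℝ ↦ expMap g.leviCivita o (r • v)) (Icc 0 1) := by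
  obtain ⟨hmax, h0, -, -⟩ := maximalGeodesic_spec' (cov := g.leviCivita) o v
  have hsub : Icc (0 : ℝ) 1 ⊆ maximalGeodesicDomain g.leviCivita o v := hmax.2.1.out h0 hv.2
  intro r hr
  exact ⟨IsGeodesicOn.mdifferentiableAt_holds (isGeodesicOn_expMap_smul (cov := g.leviCivita) o v)
    (hsub hr), isFutureDirected_velocity_expMap_smul τ hvf (hsub hr)⟩

/-- **The local formula for the time separation** (Sbierski 2016, §3.2, proof of Thm. 12:
*"`τ_q` restricted to `W` can be explicitly given by the exponential map based at `q`"*; O'Neill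
1983, Prop. 5.34). Every point `c` has an open neighbourhood `W` and a two-point inverse `Ξ` of
the exponential map on `W × W` (the package of `exists_nhds_arcLength_le_radial`, re-exported:
`W ⊆` chart source, `Ξ` smooth, `exp_p(e⁻¹_p(Ξ p q)) = q`) such that **for every causally convex
`U ⊆ W`** (future causal curve segments with endpoints in `U` stay in `U`) **and all `p, q ∈ U` with
`q ∈ J⁺(p)`, `q ≠ p`:** the vector `v = e⁻¹_p(Ξ p q) = exp_p⁻¹ q` is future causal, the vector
`w = e⁻¹_q(Ξ q p) = exp_q⁻¹ p` is past causal (`g(w, w) ≤ 0`, `0 < g(T_q, w)`), and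
`d(p, q) = |v| = |w|` (`|u| = √(-g(u, u))`), `d` the time separation of `M`. Here `e` is the
trivialisation of `TM` at `c`. [cite: Sbierski2016AHP, §3.2, proof of Thm. 12 (the display for τ_q)] -/
theorem exists_nhds_lorentzDist_eq_radial (hn : (∞ : ℕ∞ω) ≤ n) (c : M) :
    ∃ (W : Set M) (Ξ : M → M → E), IsOpen W ∧ c ∈ W ∧ W ⊆ (chartAt H c).source ∧
      ContMDiffOn (I.prod I) 𝓘(ℝ, E) ∞ (uncurry Ξ) (W ×ˢ W) ∧
      (∀ p ∈ W, ∀ q ∈ W,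
        ((trivializationAt E (TangentSpace I : M → Type _) c).symmL ℝ p (Ξ p q) :
            TangentSpace I p) ∈ expDomain g.leviCivita p ∧
          expMap g.leviCivita p
            ((trivializationAt E (TangentSpace I : M → Type _) c).symmL ℝ p (Ξ p q)) = q) ∧
      ∀ U : Set M, U ⊆ W →
        (∀ (γ : ℝ → M) (a b : ℝ), a ≤ b → g.IsFutureCausalCurveOn τ γ (Icc a b) →
          γ a ∈ U → γ b ∈ U → MapsTo γ (Icc a b) U) →
        ∀ p ∈ U, ∀ q ∈ U, q ∈ g.causalFuture τ {p} → q ≠ p →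
          τ.IsFutureDirected (x := p)
              ((trivializationAt E (TangentSpace I : M → Type _) c).symmL ℝ p (Ξ p q)) ∧
            (g.val q ((trivializationAt E (TangentSpace I : M → Type _) c).symmL ℝ q (Ξ q p))
                ((trivializationAt E (TangentSpace I : M → Type _) c).symmL ℝ q (Ξ q p)) ≤ 0 ∧
              0 < g.val q (τ.vectorField q)
                ((trivializationAt E (TangentSpace I : M → Type _) c).symmL ℝ q (Ξ q p))) ∧
            g.lorentzDist τ p q = ENNReal.ofReal (Real.sqrt (-g.val p
              ((trivializationAt E (TangentSpace I : M → Type _) c).symmL ℝ p (Ξ p q))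
              ((trivializationAt E (TangentSpace I : M → Type _) c).symmL ℝ p (Ξ p q)))) ∧
            g.lorentzDist τ p q = ENNReal.ofReal (Real.sqrt (-g.val q
              ((trivializationAt E (TangentSpace I : M → Type _) c).symmL ℝ q (Ξ q p))
              ((trivializationAt E (TangentSpace I : M → Type _) c).symmL ℝ q (Ξ q p)))) := by
  haveI : Fact (1 ≤ n) := ⟨le_trans (by exact_mod_cast le_top) hn⟩
  obtain ⟨W, Ξ, hWo, hcW, hWsrc, hΞs, hΞ, hcurve⟩ := exists_nhds_arcLength_le_radial τ hn c
  set e := trivializationAt E (TangentSpace I : M → Type _) c with he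
  refine ⟨W, Ξ, hWo, hcW, hWsrc, hΞs, hΞ, fun U hUW hUcc p hp q hq hpq hne ↦ ?_⟩
  set v : TangentSpace I p := e.symmL ℝ p (Ξ p q) with hv_def
  set w : TangentSpace I q := e.symmL ℝ q (Ξ q p) with hw_def
  have hpW : p ∈ W := hUW hp
  have hqW : q ∈ W := hUW hq
  have hvdom : v ∈ expDomain g.leviCivita p := (hΞ p hpW q hqW).1
  have hvexp : expMap g.leviCivita p v = q := (hΞ p hpW q hqW).2
  have hwdom : w ∈ expDomain g.leviCivita q := (hΞ q hqW p hpW).1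
  have hwexp : expMap g.leviCivita q w = p := (hΞ q hqW p hpW).2
  have hv0 : v ≠ 0 := fun h ↦ hne (by
    rw [← hvexp, h]; exact expMap_zero (cov := g.leviCivita) p)
  have hw0 : w ≠ 0 := fun h ↦ hne (by
    rw [← hwexp, h]; exact (expMap_zero (cov := g.leviCivita) q).symm)
  -- a causal curve from `p` to `q`; it lies in `U ⊆ W`
  obtain ⟨γ₀, a₀, b₀, hab₀, hγ₀, hγ₀a, hγ₀b⟩ : ∃ (γ : ℝ → M) (a b : ℝ), a < b ∧
      g.IsFutureCausalCurveOn τ γ (Icc a b) ∧ γ a = p ∧ γ b = q := by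
    rcases hpq with h | ⟨p', hp', γ, a, b, hab, hγ, hγa, hγb⟩
    · exact absurd (mem_singleton_iff.mp h) hne
    · rw [mem_singleton_iff] at hp'
      subst hp'
      exact ⟨γ, a, b, hab, hγ, hγa, hγb⟩
  have hγ₀W : MapsTo γ₀ (Icc a₀ b₀) W := fun t ht ↦
    hUW (hUcc γ₀ a₀ b₀ hab₀.le hγ₀ (hγ₀a ▸ hp) (hγ₀b ▸ hq) ht)
  obtain ⟨⟨hc₁, hc₂, -⟩, ⟨hd₁, hd₂, -⟩⟩ := hcurve γ₀ a₀ b₀ hab₀.le hγ₀ hγ₀W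
  rw [hγ₀a, hγ₀b] at hc₁ hc₂ hd₁ hd₂
  -- `v` is future causal, `w` is past causal
  have hvc : g.IsCausal v := ⟨hc₁, hv0⟩
  have hvf : τ.IsFutureDirected v :=
    ⟨hvc, lt_of_le_of_ne hc₂ (g.val_ne_zero_of_isTimelike_of_isCausal (τ.isTimelike p) hvc)⟩
  have hwc : g.IsCausal w := ⟨hd₁, hw0⟩
  have hTw : 0 < g.val q (τ.vectorField q) w :=
    lt_of_le_of_ne hd₂ (g.val_ne_zero_of_isTimelike_of_isCausal (τ.isTimelike q) hwc).symm
  have hwf : τ.reverse.IsFutureDirected w := by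
    rw [TimeOrientation.isFutureDirected_reverse_iff]
    exact ⟨hwc, hTw⟩
  -- the upper bounds from the local twin paradox on `U`
  have hle₁ : g.lorentzDist τ p q ≤ ENNReal.ofReal (Real.sqrt (-g.val p v v)) := by
    refine lorentzDist_le_iff.2 fun γ a b hab hγ hγa hγb ↦ ?_
    have hγW : MapsTo γ (Icc a b) W := fun t ht ↦
      hUW (hUcc γ a b hab.le hγ (hγa ▸ hp) (hγb ▸ hq) ht)
    obtain ⟨⟨-, -, h⟩, -⟩ := hcurve γ a b hab.le hγ hγW
    rw [hγa, hγb] at h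
    exact h
  have hle₂ : g.lorentzDist τ p q ≤ ENNReal.ofReal (Real.sqrt (-g.val q w w)) := by
    refine lorentzDist_le_iff.2 fun γ a b hab hγ hγa hγb ↦ ?_
    have hγW : MapsTo γ (Icc a b) W := fun t ht ↦
      hUW (hUcc γ a b hab.le hγ (hγa ▸ hp) (hγb ▸ hq) ht)
    obtain ⟨-, ⟨-, -, h⟩⟩ := hcurve γ a b hab.le hγ hγW
    rw [hγa, hγb] at h
    exact h
  -- the lower bounds from the radial geodesics
  have hge₁ : ENNReal.ofReal (Real.sqrt (-g.val p v v)) ≤ g.lorentzDist τ p q := by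
    rw [← arcLength_expMap_smul hn p hvdom hc₁]
    refine arcLength_le_lorentzDist zero_lt_one (isFutureCausalCurveOn_expMap_smul τ hvdom hvf)
      ?_ ?_
    · show expMap g.leviCivita p ((0 : ℝ) • v) = p
      rw [zero_smul]; exact expMap_zero (cov := g.leviCivita) p
    · show expMap g.leviCivita p ((1 : ℝ) • v) = q
      rw [one_smul]; exact hvexp
  have hge₂ : ENNReal.ofReal (Real.sqrt (-g.val q w w)) ≤ g.lorentzDist τ p q := by
    -- the radial geodesic from `q` with velocity `w`, traversed backwards, runs from `p` to `q`
    have hrad : g.IsFutureCausalCurveOn τ.reverse (fun r : ℝ ↦ expMap g.leviCivita q (r • w))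
        (Icc 0 1) := isFutureCausalCurveOn_expMap_smul τ.reverse hwdom hwf
    have hrev : g.IsFutureCausalCurveOn τ
        (fun r : ℝ ↦ expMap g.leviCivita q ((0 + 1 - r) • w)) (Icc 0 1) :=
      isFutureCausalCurveOn_reverse_reverse_iff.mp hrad.reverseParam
    rw [← arcLength_expMap_smul hn q hwdom hd₁,
      ← PseudoRiemannianMetric.arcLength_reverse (fun r : ℝ ↦ expMap g.leviCivita q (r • w)) 0 1]
    refine arcLength_le_lorentzDist zero_lt_one hrev ?_ ?_
    · show expMap g.leviCivita q ((0 + 1 - 0 : ℝ) • w) = p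
      rw [show (0 + 1 - 0 : ℝ) = 1 by norm_num, one_smul]; exact hwexp
    · show expMap g.leviCivita q ((0 + 1 - 1 : ℝ) • w) = q
      rw [show (0 + 1 - 1 : ℝ) = 0 by norm_num, zero_smul]
      exact expMap_zero (cov := g.leviCivita) q
  exact ⟨hvf, ⟨hd₁, hTw⟩, le_antisymm hle₁ hge₁, le_antisymm hle₂ hge₂⟩

end LorentzianMetric

end Literature.Geometry.Lorentzian

end
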